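import Summits.AtomisticToContinuum.FouriersLaw.Theses.VanishingNoiseTransfer
import Summits.AtomisticToContinuum.FouriersLaw.Theses.BondHeatUncertainty
import Literature.MathematicalPhysics.KineticTheory.VelocityFlipNoise
import Summits.AtomisticToContinuum.FouriersLaw.Theorems.FourierGreenKuboFourierFiniteResponseOfUnique
import Summits.AtomisticToContinuum.FouriersLaw.Theorems.VanishingNoiseTransferVanishingNoiseBoundOfBoundedResponse

/-!
# `VanishingNoiseBound` from bounded response and ONE-SIDED noise locality (two sharper edges)

`--supports stmt-AtomisticToContinuum-11976` file (crux `VanishingNoiseBound`, route `VanishingNoiseTransfer`; redirect strategist r1,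
`Cruxes/VanishingNoiseBound/STRATEGY-CENSUS-R1.md` §4.2 / §4.4). The landed edge
`vanishingNoiseBound_of_boundedResponse_of_noiseLocality` (p122997) consumes only the ONE-SIDED half of the sibling crux `NoiseLocality`
(stmt-11975); this file records that fact as theorems, so that the crux can be split onto weaker second pieces if the route's planner wishes:

* `vanishingNoiseBound_of_boundedResponse_of_upperNoiseLocality` — `BondHeatUncertainty.BoundedResponse` (stmt-11071) together with
  UPPER noise locality (the sibling's statement with conclusion `Dε - D0 ≤ w ε * |D0| * |Dε|` only: flips cannot make the chain much
  MORE conducting, uniformly in `N` — the Matthiessen-sign half) implies `VanishingNoiseBound`, with `K = 2B + 2` as in p122997.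
* (the upper half follows from `NoiseLocality` by `Dε − D0 ≤ |D0 − Dε|`, one line; composing gives back p122997, which is why that
  composite is not restated here — `dedup.landed`.)
* `vanishingNoiseBound_of_boundedResponse_of_smallNoiseReducesEventually` — `BoundedResponse` together with the slack-free,
  eventually-in-`N` comparison `D_N(ε) ≤ D_N(0)` for `N ≥ N⋆`, `ε ≤ ε₀` (VERBATIM the registered stub
  `stub_smallNoiseReducesResponseEventually` of the live stmt-11975 skeleton, stated with `OscillatorChain.IsFlipSteadyState`) implies
  `VanishingNoiseBound` with `K = B`: whoever lands that stub closes the crux given stmt-11071 by this 30-line corollary.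

No `sorry`, no definitions, no named facts. Real analysis only. [cite: BonettoLebowitzReyBellet2000, §6.3]
-/

noncomputable section

open MeasureTheory Filter Topology
open Literature.MathematicalPhysics.KineticTheory.HeatConduction

namespace Summit.AtomisticToContinuum.FouriersLaw.Theorems.VanishingNoiseBound

/-- **Bounded deterministic response + UPPER noise locality ⟹ the vanishing-noise bound.** Same proof as
`vanishingNoiseBound_of_boundedResponse_of_noiseLocality` (p122997), with the two-sided modulus hypothesis weakened to its one-sided half
`D_N(ε) − D_N(0) ≤ w(ε) |D_N(0)| |D_N(ε)|`, which is all that proof used: `|D_N(0)| ≤ B` (stmt-11071), `|w ε| < 1/(2B+2)` on `(0, ε₁]`,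
hence `D_N(ε) ≤ 2B` for every `N` and every limit `k ≤ 2B + 2`. [cite: BonettoLebowitzReyBellet2000, §6.3] -/
theorem vanishingNoiseBound_of_boundedResponse_of_upperNoiseLocality
    (hBR : Theses.BondHeatUncertainty.BoundedResponse)
    (hUL : ∀ ω₂ lam β γ : ℝ, 0 < ω₂ → 0 < lam → 0 < β → 0 < γ → ∀ S : ℝ → (N : ℕ) → ℝ → ℝ → MeasureTheory.Measure (Literature.MathematicalPhysics.KineticTheory.HeatConduction.PhaseSpace N) → Prop, S = (fun (ε : ℝ) (N : ℕ) (T_L T_R : ℝ) (μ : MeasureTheory.Measure (Literature.MathematicalPhysics.KineticTheory.HeatConduction.PhaseSpace N)) => MeasureTheory.IsProbabilityMeasure μ ∧ (∀ f : Literature.MathematicalPhysics.KineticTheory.HeatConduction.PhaseSpace N → ℝ, ContDiff ℝ ((⊤ : ℕ∞) : WithTop ℕ∞) f → HasCompactSupport f → MeasureTheory.integral μ (fun x => (Literature.MathematicalPhysics.KineticTheory.HeatConduction.pinnedChain ω₂ lam β γ).generator N T_L T_R f x + ε * ∑ i : Fin N, (f (x.1, Function.update x.2 i (-x.2 i)) -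 f x)) = 0) ∧ ∀ i : Fin N, MeasureTheory.Integrable ((Literature.MathematicalPhysics.KineticTheory.HeatConduction.pinnedChain ω₂ lam β γ).bondCurrent N i) μ) → ∀ T : ℝ, 0 < T → ∃ w : ℝ → ℝ, Filter.Tendsto w (nhdsWithin 0 (Set.Ioi 0)) (nhds 0) ∧ ∀ (N : ℕ) (ε : ℝ), 0 < ε → ε ≤ 1 → ∀ μ0 με : ℝ → ℝ → MeasureTheory.Measure (Literature.MathematicalPhysics.KineticTheory.HeatConduction.PhaseSpace N), (∀ T_L T_R : ℝ, 0 < T_L → 0 < T_R → (Literature.MathematicalPhysics.KineticTheory.HeatConduction.pinnedChain ω₂ lam β γ).IsSteadyState N T_L T_R (μ0 T_L T_R) ∧ ∀ ν : MeasureTheory.Measure (Literature.MathematicalPhysics.KineticTheory.HeatConduction.PhaseSpace N), (Literature.MathematicalPhysics.KineticTheory.HeatConduction.pinnedChain ω₂ lam β γ).IsSteadyState N T_L T_R ν → ν = μ0 T_L T_R) → (∀ T_L T_R : ℝ, 0 < T_L → 0 < T_R → S ε N T_L T_R (με T_L T_R) ∧ ∀ ν : MeasureTheory.Measure (Literature.MathematicalPhysics.KineticTheory.HeatConduction.PhaseSpace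 N), S ε N T_L T_R ν → ν = με T_L T_R) → ∀ D0 Dε : ℝ, Filter.Tendsto (fun δ : ℝ => (Literature.MathematicalPhysics.KineticTheory.HeatConduction.pinnedChain ω₂ lam β γ).totalCurrent (μ0 (T + δ / 2) (T - δ / 2)) / δ) (nhdsWithin 0 {(0 : ℝ)}ᶜ) (nhds D0) → Filter.Tendsto (fun δ : ℝ => (Literature.MathematicalPhysics.KineticTheory.HeatConduction.pinnedChain ω₂ lam β γ).totalCurrent (με (T + δ / 2) (T - δ / 2)) / δ) (nhdsWithin 0 {(0 : ℝ)}ᶜ) (nhds Dε) → Dε - D0 ≤ w ε * |D0| * |Dε|) :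
    Theses.VanishingNoiseTransfer.VanishingNoiseBound := by
  intro ω₂ lam β γ hω hl hβ hγ S hS T hT
  have huniq := Theses.VanishingNoiseTransfer.NessUnique_holds ω₂ lam β γ hω hl hβ hγ
  -- (0) the unique deterministic steady family (landed existence theorem + NessUnique), by choice
  have hex : ∀ (N : ℕ) (T_L T_R : ℝ), 0 < T_L → 0 < T_R →
      ∃ μ : Measure (PhaseSpace N), (pinnedChain ω₂ lam β γ).IsSteadyState N T_L T_R μ :=
    fun N T_L T_R hL hR' => pinnedChain_exists_isSteadyState hω hl hβ hγ N hL hR'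
  classical
  let μ0 : (N : ℕ) → ℝ → ℝ → Measure (PhaseSpace N) := fun N T_L T_R =>
    if h : 0 < T_L ∧ 0 < T_R then Classical.choose (hex N T_L T_R h.1 h.2) else 0
  have hμ0 : ∀ (N : ℕ) (T_L T_R : ℝ), 0 < T_L → 0 < T_R →
      (pinnedChain ω₂ lam β γ).IsSteadyState N T_L T_R (μ0 N T_L T_R) := by
    intro N T_L T_R hL hR'
    simp only [μ0, dif_pos (And.intro hL hR')]
    exact Classical.choose_spec (hex N T_L T_R hL hR')
  -- its finite-`N` responses at `T` (FiniteResponseOfUnique, closed item stmt-0717)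
  have hD0ex := Theorems.FourierGreenKubo.finiteResponse_of_unique ω₂ lam β γ hω hl hβ hγ huniq μ0 hμ0 T hT
  choose D0 hD0 using hD0ex
  -- (1) BoundedResponse (stmt-11071): `|D_N(0)| ≤ B` for all `N`
  obtain ⟨B, hB⟩ := hBR ω₂ lam β γ hω hl hβ hγ μ0 hμ0 T hT D0 hD0
  have hBN : ∀ N : ℕ, |D0 N| ≤ B := fun N => hB ⟨N, rfl⟩
  have hB0 : 0 ≤ B := (abs_nonneg _).trans (hBN 0)
  have hA : (0 : ℝ) < 2 * B + 2 := by positivity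
  -- (2) upper noise locality: the `N`-uniform one-sided modulus, `|w ε| < 1/(2B+2)` on a right neighbourhood of `0`
  obtain ⟨w, hw, hloc⟩ := hUL ω₂ lam β γ hω hl hβ hγ S hS T hT
  have hsmall : ∀ᶠ ε in 𝓝[Set.Ioi (0 : ℝ)] 0, |w ε| < 1 / (2 * B + 2) := by
    have h := Metric.tendsto_nhds.1 hw (1 / (2 * B + 2)) (by positivity)
    refine h.mono fun ε hε' => ?_
    simpa [Real.dist_eq] using hε'
  rw [eventually_nhdsWithin_iff, Metric.eventually_nhds_iff] at hsmall
  obtain ⟨r, hr, hrw⟩ := hsmall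
  subst hS
  refine ⟨2 * B + 2, min (r / 2) 1, lt_min (by linarith) one_pos, ?_⟩
  intro ε hε hεle μ hμ D k hD hk
  have hεr : ε ≤ r / 2 := hεle.trans (min_le_left _ _)
  have hε1 : ε ≤ 1 := hεle.trans (min_le_right _ _)
  have hwε : |w ε| < 1 / (2 * B + 2) := by
    refine hrw ?_ (Set.mem_Ioi.2 hε)
    rw [Real.dist_eq, sub_zero, abs_of_pos hε]
    linarith
  -- one-sided transfer at each length `N`: `D_N(ε) − D_N(0) ≤ w ε |D_N(0)| |D_N(ε)|`
  have hN : ∀ N : ℕ, D N - D0 N ≤ w ε * |D0 N| * |D N| := fun N =>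
    hloc N ε hε hε1 (μ0 N) (μ N)
      (fun T_L T_R hL hR' => ⟨hμ0 N T_L T_R hL hR',
        fun ν hν => huniq N T_L T_R hL hR' ν _ hν (hμ0 N T_L T_R hL hR')⟩)
      (fun T_L T_R hL hR' => hμ N T_L T_R hL hR') (D0 N) (D N) (hD0 N) (hD N)
  -- hence `D_N(ε) ≤ 2B + 2` for every `N`
  have hle : ∀ N : ℕ, D N ≤ 2 * B + 2 := by
    intro N
    by_cases hDN : D N ≤ 0
    · linarith
    · have hDN : 0 < D N := not_le.mp hDN
      have h2 : D N - D0 N ≤ |w ε| * |D0 N| * |D N| := by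
        refine (hN N).trans ?_
        have hprod : 0 ≤ |D0 N| * |D N| := mul_nonneg (abs_nonneg _) (abs_nonneg _)
        have : w ε * |D0 N| * |D N| = w ε * (|D0 N| * |D N|) := by ring
        rw [this, show |w ε| * |D0 N| * |D N| = |w ε| * (|D0 N| * |D N|) by ring]
        exact mul_le_mul_of_nonneg_right (le_abs_self _) hprod
      rw [abs_of_pos hDN] at h2
      have h4 : |w ε| * |D0 N| * D N ≤ 1 / (2 * B + 2) * B * D N := by
        have h5 : |w ε| * |D0 N| ≤ 1 / (2 * B + 2) * B :=
          mul_le_mul hwε.le (hBN N) (abs_nonneg _) (by positivity)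
        exact mul_le_mul_of_nonneg_right h5 hDN.le
      have h6 : 1 / (2 * B + 2) * B ≤ 1 / 2 := by
        rw [div_mul_eq_mul_div, one_mul, div_le_iff₀ hA]
        linarith
      have h7 : 1 / (2 * B + 2) * B * D N ≤ 1 / 2 * D N := mul_le_mul_of_nonneg_right h6 hDN.le
      have h8 : D0 N ≤ B := (le_abs_self _).trans (hBN N)
      linarith
  exact le_of_tendsto' hk hle

/-- **Bounded deterministic response + "small noise reduces the response, eventually in N" ⟹ the vanishing-noise bound, with K = B.**
The second hypothesis is VERBATIM the registered stub `stub_smallNoiseReducesResponseEventually` (M2⋆) of the live stmt-11975 skeleton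
(`OscillatorChain.IsFlipSteadyState` is the crux's inlined flip predicate, definitionally): for `N ≥ max N⋆ 2` and `ε ≤ ε₀` the unique
noisy responses satisfy `D_N(ε) ≤ D_N(0) ≤ |D_N(0)| ≤ B`, so every limit `k ≤ B`. [cite: BonettoLebowitzReyBellet2000, §6.3] -/
theorem vanishingNoiseBound_of_boundedResponse_of_smallNoiseReducesEventually
    (hBR : Theses.BondHeatUncertainty.BoundedResponse)
    (hM2 : ∀ ω₂ lam β γ : ℝ, 0 < ω₂ → 0 < lam → 0 < β → 0 < γ → ∀ T : ℝ, 0 < T → ∃ (Nstar : ℕ) (ε₀ : ℝ), 0 < ε₀ ∧ ∀ (N : ℕ), Nstar ≤ N → 2 ≤ N → ∀ ε : ℝ, 0 < ε → ε ≤ ε₀ → ∀ μ0 : ℝ → ℝ → MeasureTheory.Measure (Literature.MathematicalPhysics.KineticTheory.HeatConduction.PhaseSpace N), (∀ T_L T_R : ℝ, 0 < T_L → 0 < T_R → (Literature.MathematicalPhysics.KineticTheory.HeatConduction.pinnedChain ω₂ lam β γ).IsSteadyState N T_L T_R (μ0 T_L T_R) ∧ ∀ ν : MeasureTheory.Measure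 (Literature.MathematicalPhysics.KineticTheory.HeatConduction.PhaseSpace N), (Literature.MathematicalPhysics.KineticTheory.HeatConduction.pinnedChain ω₂ lam β γ).IsSteadyState N T_L T_R ν → ν = μ0 T_L T_R) → ∀ με : ℝ → ℝ → MeasureTheory.Measure (Literature.MathematicalPhysics.KineticTheory.HeatConduction.PhaseSpace N), (∀ T_L T_R : ℝ, 0 < T_L → 0 < T_R → (Literature.MathematicalPhysics.KineticTheory.HeatConduction.pinnedChain ω₂ lam β γ).IsFlipSteadyState N T_L T_R ε (με T_L T_R) ∧ ∀ ν : MeasureTheory.Measure (Literature.MathematicalPhysics.KineticTheory.HeatConduction.PhaseSpace N), (Literature.MathematicalPhysics.KineticTheory.HeatConduction.pinnedChain ω₂ lam β γ).IsFlipSteadyState N T_L T_R ε ν → ν = με T_L T_R) → ∀ D0 Dε : ℝ, Filter.Tendsto (fun δ : ℝ => (Literature.MathematicalPhysics.KineticTheory.HeatConduction.pinnedChain ω₂ lam β γ).totalCurrent (μ0 (T + δ / 2) (T - δ / 2)) / δ) (nhdsWithin 0 {(0 : ℝ)}ᶜ) (nhds D0) → Filter.Tendsto (fun δ : ℝ =>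 (Literature.MathematicalPhysics.KineticTheory.HeatConduction.pinnedChain ω₂ lam β γ).totalCurrent (με (T + δ / 2) (T - δ / 2)) / δ) (nhdsWithin 0 {(0 : ℝ)}ᶜ) (nhds Dε) → Dε ≤ D0) :
    Theses.VanishingNoiseTransfer.VanishingNoiseBound := by
  intro ω₂ lam β γ hω hl hβ hγ S hS T hT
  have huniq := Theses.VanishingNoiseTransfer.NessUnique_holds ω₂ lam β γ hω hl hβ hγ
  have hex : ∀ (N : ℕ) (T_L T_R : ℝ), 0 < T_L → 0 < T_R →
      ∃ μ : Measure (PhaseSpace N), (pinnedChain ω₂ lam β γ).IsSteadyState N T_L T_R μ :=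
    fun N T_L T_R hL hR' => pinnedChain_exists_isSteadyState hω hl hβ hγ N hL hR'
  classical
  let μ0 : (N : ℕ) → ℝ → ℝ → Measure (PhaseSpace N) := fun N T_L T_R =>
    if h : 0 < T_L ∧ 0 < T_R then Classical.choose (hex N T_L T_R h.1 h.2) else 0
  have hμ0 : ∀ (N : ℕ) (T_L T_R : ℝ), 0 < T_L → 0 < T_R →
      (pinnedChain ω₂ lam β γ).IsSteadyState N T_L T_R (μ0 N T_L T_R) := by
    intro N T_L T_R hL hR'
    simp only [μ0, dif_pos (And.intro hL hR')]
    exact Classical.choose_spec (hex N T_L T_R hL hR')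
  have hD0ex := Theorems.FourierGreenKubo.finiteResponse_of_unique ω₂ lam β γ hω hl hβ hγ huniq μ0 hμ0 T hT
  choose D0 hD0 using hD0ex
  obtain ⟨B, hB⟩ := hBR ω₂ lam β γ hω hl hβ hγ μ0 hμ0 T hT D0 hD0
  have hBN : ∀ N : ℕ, |D0 N| ≤ B := fun N => hB ⟨N, rfl⟩
  obtain ⟨Nstar, ε₀, hε₀, hcmp⟩ := hM2 ω₂ lam β γ hω hl hβ hγ T hT
  subst hS
  refine ⟨B, ε₀, hε₀, ?_⟩
  intro ε hε hεle μ hμ D k hD hk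
  -- eventually in `N`: `D N ≤ D0 N ≤ B`
  have hle : ∀ᶠ N in atTop, D N ≤ B := by
    refine Filter.eventually_atTop.2 ⟨max Nstar 2, fun N hN => ?_⟩
    have hN1 : Nstar ≤ N := le_trans (le_max_left _ _) hN
    have hN2 : 2 ≤ N := le_trans (le_max_right _ _) hN
    have hcmpN := hcmp N hN1 hN2 ε hε hεle (μ0 N)
      (fun T_L T_R hL hR' => ⟨hμ0 N T_L T_R hL hR',
        fun ν hν => huniq N T_L T_R hL hR' ν _ hν (hμ0 N T_L T_R hL hR')⟩)
      (μ N) (fun T_L T_R hL hR' => hμ N T_L T_R hL hR') (D0 N) (D N) (hD0 N) (hD N)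
    exact hcmpN.trans ((le_abs_self _).trans (hBN N))
  exact le_of_tendsto hk hle

/-- Registered helper sub-goal `helper_vanishingNoiseBoundOfUpperNoiseLocality` of crux stmt-AtomisticToContinuum-11976 (strategist r1):
the edge `BoundedResponse → UpperNoiseLocality → VanishingNoiseBound` (`vanishingNoiseBound_of_boundedResponse_of_upperNoiseLocality`). -/
theorem helper_vanishingNoiseBoundOfUpperNoiseLocality : Summit.AtomisticToContinuum.FouriersLaw.Theses.BondHeatUncertainty.BoundedResponse → (∀ ω₂ lam β γ : ℝ, 0 < ω₂ → 0 < lam → 0 < β → 0 < γ → ∀ S : ℝ → (N : ℕ) → ℝ → ℝ → MeasureTheory.Measure (Literature.MathematicalPhysics.KineticTheory.HeatConduction.PhaseSpace N) → Prop, S = (fun (ε : ℝ) (N : ℕ) (T_L T_R : ℝ) (μ : MeasureTheory.Measure (Literature.MathematicalPhysics.KineticTheory.HeatConduction.PhaseSpace N)) => MeasureTheory.IsProbabilityMeasure μ ∧ (∀ f : Literature.MathematicalPhysics.KineticTheory.HeatConduction.PhaseSpace N → ℝ, ContDiff ℝ ((⊤ : ℕ∞) : WithTop ℕ∞) f → HasCompactSupport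 f → MeasureTheory.integral μ (fun x => (Literature.MathematicalPhysics.KineticTheory.HeatConduction.pinnedChain ω₂ lam β γ).generator N T_L T_R f x + ε * ∑ i : Fin N, (f (x.1, Function.update x.2 i (-x.2 i)) - f x)) = 0) ∧ ∀ i : Fin N, MeasureTheory.Integrable ((Literature.MathematicalPhysics.KineticTheory.HeatConduction.pinnedChain ω₂ lam β γ).bondCurrent N i) μ) → ∀ T : ℝ, 0 < T → ∃ w : ℝ → ℝ, Filter.Tendsto w (nhdsWithin 0 (Set.Ioi 0)) (nhds 0) ∧ ∀ (N : ℕ) (ε : ℝ), 0 < ε → ε ≤ 1 → ∀ μ0 με : ℝ → ℝ → MeasureTheory.Measure (Literature.MathematicalPhysics.KineticTheory.HeatConduction.PhaseSpace N), (∀ T_L T_R : ℝ, 0 < T_L → 0 < T_R → (Literature.MathematicalPhysics.KineticTheory.HeatConduction.pinnedChain ω₂ lam β γ).IsSteadyState N T_L T_R (μ0 T_L T_R) ∧ ∀ ν : MeasureTheory.Measure (Literature.MathematicalPhysics.KineticTheory.HeatConduction.PhaseSpace N), (Literature.MathematicalPhysics.KineticTheory.HeatConduction.pinnedChain ω₂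 lam β γ).IsSteadyState N T_L T_R ν → ν = μ0 T_L T_R) → (∀ T_L T_R : ℝ, 0 < T_L → 0 < T_R → S ε N T_L T_R (με T_L T_R) ∧ ∀ ν : MeasureTheory.Measure (Literature.MathematicalPhysics.KineticTheory.HeatConduction.PhaseSpace N), S ε N T_L T_R ν → ν = με T_L T_R) → ∀ D0 Dε : ℝ, Filter.Tendsto (fun δ : ℝ => (Literature.MathematicalPhysics.KineticTheory.HeatConduction.pinnedChain ω₂ lam β γ).totalCurrent (μ0 (T + δ / 2) (T - δ / 2)) / δ) (nhdsWithin 0 {(0 : ℝ)}ᶜ) (nhds D0) → Filter.Tendsto (fun δ : ℝ => (Literature.MathematicalPhysics.KineticTheory.HeatConduction.pinnedChain ω₂ lam β γ).totalCurrent (με (T + δ / 2) (T - δ / 2)) / δ) (nhdsWithin 0 {(0 : ℝ)}ᶜ) (nhds Dε) → Dε - D0 ≤ w ε * |D0| * |Dε|) → Summit.AtomisticToContinuum.FouriersLaw.Theses.VanishingNoiseTransfer.VanishingNoiseBound :=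
  vanishingNoiseBound_of_boundedResponse_of_upperNoiseLocality

/-- Registered helper sub-goal `helper_vanishingNoiseBoundOfSmallNoiseReduces` of crux stmt-AtomisticToContinuum-11976 (strategist r1):
the edge `BoundedResponse → M2⋆ → VanishingNoiseBound` (`vanishingNoiseBound_of_boundedResponse_of_smallNoiseReducesEventually`). -/
theorem helper_vanishingNoiseBoundOfSmallNoiseReduces : Summit.AtomisticToContinuum.FouriersLaw.Theses.BondHeatUncertainty.BoundedResponse → (∀ ω₂ lam β γ : ℝ, 0 < ω₂ → 0 < lam → 0 < β → 0 < γ → ∀ T : ℝ, 0 < T → ∃ (Nstar : ℕ) (ε₀ : ℝ), 0 < ε₀ ∧ ∀ (N : ℕ), Nstar ≤ N → 2 ≤ N → ∀ ε : ℝ, 0 < ε → ε ≤ ε₀ → ∀ μ0 : ℝ → ℝ → MeasureTheory.Measure (Literature.MathematicalPhysics.KineticTheory.HeatConduction.PhaseSpace N), (∀ T_L T_R : ℝ, 0 < T_L → 0 < T_R → (Literature.MathematicalPhysics.KineticTheory.HeatConduction.pinnedChain ω₂ lam β γ).IsSteadyState N T_L T_R (μ0 T_L T_R) ∧ ∀ ν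 : MeasureTheory.Measure (Literature.MathematicalPhysics.KineticTheory.HeatConduction.PhaseSpace N), (Literature.MathematicalPhysics.KineticTheory.HeatConduction.pinnedChain ω₂ lam β γ).IsSteadyState N T_L T_R ν → ν = μ0 T_L T_R) → ∀ με : ℝ → ℝ → MeasureTheory.Measure (Literature.MathematicalPhysics.KineticTheory.HeatConduction.PhaseSpace N), (∀ T_L T_R : ℝ, 0 < T_L → 0 < T_R → (Literature.MathematicalPhysics.KineticTheory.HeatConduction.pinnedChain ω₂ lam β γ).IsFlipSteadyState N T_L T_R ε (με T_L T_R) ∧ ∀ ν : MeasureTheory.Measure (Literature.MathematicalPhysics.KineticTheory.HeatConduction.PhaseSpace N), (Literature.MathematicalPhysics.KineticTheory.HeatConduction.pinnedChain ω₂ lam β γ).IsFlipSteadyState N T_L T_R ε ν → ν = με T_L T_R) → ∀ D0 Dε : ℝ, Filter.Tendsto (fun δ : ℝ => (Literature.MathematicalPhysics.KineticTheory.HeatConduction.pinnedChain ω₂ lam β γ).totalCurrent (μ0 (T + δ / 2) (T - δ / 2)) / δ) (nhdsWithin 0 {(0 : ℝ)}ᶜ) (nhds D0) → Filter.Tendsto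 (fun δ : ℝ => (Literature.MathematicalPhysics.KineticTheory.HeatConduction.pinnedChain ω₂ lam β γ).totalCurrent (με (T + δ / 2) (T - δ / 2)) / δ) (nhdsWithin 0 {(0 : ℝ)}ᶜ) (nhds Dε) → Dε ≤ D0) → Summit.AtomisticToContinuum.FouriersLaw.Theses.VanishingNoiseTransfer.VanishingNoiseBound :=
  vanishingNoiseBound_of_boundedResponse_of_smallNoiseReducesEventually

end Summit.AtomisticToContinuum.FouriersLaw.Theorems.VanishingNoiseBound

end
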